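import Mathlib
import Summits.RiemannHypothesis.RiemannHypothesis.Theorems.WeilFarFloorLogRieszExplicit
import HarnessLib

/-!
# The `t^{-3/2}`-weighted first moment of `ψ(t) − t` is BOUNDED under RH

Helper file (`--supports stmt-RiemannHypothesis-0098`, lead-track anchor: Weil-positivity window ladder, format-C far bound),
pure proofs over BUILT imports.  Seat rh-explicit-weil-1 gen16 (memo `run/shared/lean/pub/rh-explicit/rh-explicit-weil-1/FORMAT-K3.md`
§17).

The second-order law of the far-coercivity floor (`WeilFarFloorSecondOrderLawRH` / `…ExactRH`, gen15) identifies the coefficient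
of the floor gap `λ_max(a) − R_c(a)` with the residual energy `J(a)` of the cosh profile, and `J(a)` is, up to `O(√J + 1)`, the
autocorrelation energy at lag `2a` of the Cramér function `g(u) = e^{−u/2}(ψ(e^u) − e^u)`, whose mean square is
`β₂ = Σ_ρ m(ρ)²/|ρ|²` (Montgomery–Vaughan Thm. 13.6, Literature `CramerMeanSquare`) — that reduction is the companion file
`WeilFarFloorResidualEnergyCramer` of this seat.  The Cesàro average over `a` of that
autocorrelation is controlled by the PRIMITIVE `G(V) = ∫₀^V g(u) du = ∫₁^{e^V} (ψ(t) − t) t^{−3/2} dt`, and this file proves that it is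
bounded under RH:
* §1 (RH-free) integration by parts against the absolutely continuous `R₁ = ψ₁ − t²/2` (`R₁' = ψ − t` from the right):
  `∫₁^Y (ψ(t) − t)t^{−3/2} dt = R₁(Y)Y^{−3/2} + ½ + (3/2)∫₁^Y R₁(t)t^{−5/2} dt` (`integral_psi_sub_mul_rpow_eq`);
* §2 (RH-free) the explicit formula for `ψ₁` (Literature `psiOne_eq_explicit`, MV (13.7)) term by term under the integral sign
  (dominated convergence, as in `WeilFarFloorLogRieszExplicit`): `∫₁^Y Z(t)t^{−5/2} dt = Σ_ρ m(ρ)(Y^{ρ−1/2} − 1)/(ρ(ρ+1)(ρ − ½))`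
  (`integral_Zsum_mul_rpow`);
* §3 under RH `|Y^{ρ−1/2}| = 1`, `|ρ − ½| = |γ| ≥ 2δ`, so the series is bounded by `(1/δ)Σ_ρ m(ρ)/|ρ|²` uniformly in `Y`, and with
  `|R₁(t)| ≤ C t^{3/2}` (Literature `NicolasJExplicit.exists_abs_Rone_le_of_RH`):
  **`RH → ∃ C, ∀ Y ≥ 1, |∫₁^Y (ψ(t) − t) t^{−3/2} dt| ≤ C`** (`exists_abs_integral_psi_sub_mul_rpow_le_of_RH`) and, after `t = e^u`,
  **`RH → ∃ C, ∀ V ≥ 0, |∫₀^V e^{−u/2}(ψ(e^u) − e^u) du| ≤ C`** (`exists_abs_integral_cramerFn_le_of_RH`).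
Standard axioms only; RH enters as Mathlib's `RiemannHypothesis`.  Nothing here bears on the truth of RH.
-/

set_option linter.dupNamespace false
set_option autoImplicit false

noncomputable section

open MeasureTheory Set Filter Topology intervalIntegral Complex
open scoped Real BigOperators ArithmeticFunction.vonMangoldt Chebyshev

namespace Summit.RiemannHypothesis.RiemannHypothesis.Theorems.WeilFormatC

namespace FloorResidualMean

open Literature.NumberTheory.LFunctions NicolasJ NicolasJExplicit NicolasSqrtAverage LogRieszExplicit

/-! ## §1 Integration by parts against `t^{−3/2}` -/

/-- `ψ₁(1) = 0`, so `R₁(1) = −1/2`. -/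
theorem Rone_one : Rone 1 = -(1 / 2) := by simp [Rone, psiOne]

/-- **`∫_{(1,Y]} (ψ(t) − t)t^{−3/2} dt = R₁(Y)Y^{−3/2} + ½ + (3/2)∫_{(1,Y]} R₁(t)t^{−5/2} dt`** for `Y ≥ 1`
(right-derivative FTC for `R₁(t)t^{−3/2}`, `R₁ = ψ₁ − t²/2`). -/
theorem integral_psi_sub_mul_rpow_eq {Y : ℝ} (hY : 1 ≤ Y) :
    ∫ t in Ioc 1 Y, (ψ t - t) * t ^ (-(3 / 2 : ℝ))
      = Rone Y * Y ^ (-(3 / 2 : ℝ)) + 1 / 2 + 3 / 2 * ∫ t in Ioc 1 Y, Rone t * t ^ (-(5 / 2 : ℝ)) := by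
  have hderiv : ∀ t ∈ Ioo (min 1 Y) (max 1 Y),
      HasDerivWithinAt (fun t ↦ Rone t * t ^ (-(3 / 2 : ℝ)))
        ((ψ t - t) * t ^ (-(3 / 2 : ℝ)) - 3 / 2 * (Rone t * t ^ (-(5 / 2 : ℝ)))) (Ioi t) t := by
    intro t ht
    rw [min_eq_left hY, max_eq_right hY] at ht
    have ht0 : 0 < t := by linarith [ht.1]
    have hR : HasDerivWithinAt Rone (ψ t - t) (Ioi t) t := by
      have h1 := hasDerivWithinAt_psiOne t
      have h2 : HasDerivWithinAt (fun s : ℝ ↦ s ^ 2 / 2) t (Ioi t) t :=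
        (((hasDerivAt_pow 2 t).div_const 2).hasDerivWithinAt (s := Ioi t)).congr_deriv (by norm_num)
      exact h1.sub h2
    have hpow : HasDerivWithinAt (fun s : ℝ ↦ s ^ (-(3 / 2 : ℝ))) (-(3 / 2 : ℝ) * t ^ (-(5 / 2 : ℝ))) (Ioi t) t :=
      ((Real.hasDerivAt_rpow_const (p := -(3 / 2 : ℝ)) (Or.inl ht0.ne')).hasDerivWithinAt (s := Ioi t)).congr_deriv
        (by norm_num)
    exact (hR.mul hpow).congr_deriv (by ring)
  have hcont : ContinuousOn (fun t ↦ Rone t * t ^ (-(3 / 2 : ℝ))) (uIcc 1 Y) := by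
    refine continuous_Rone.continuousOn.mul (continuousOn_id.rpow_const fun t ht ↦ Or.inl ?_)
    rw [uIcc_of_le hY] at ht
    exact (show (0 : ℝ) < t by linarith [ht.1]).ne'
  have hint1 : IntervalIntegrable (fun t ↦ (ψ t - t) * t ^ (-(3 / 2 : ℝ))) volume 1 Y := by
    refine ((intervalIntegrable_psi 1 Y).sub intervalIntegrable_id).mul_continuousOn
      (continuousOn_id.rpow_const fun t ht ↦ Or.inl ?_)
    rw [uIcc_of_le hY] at ht
    exact (show (0 : ℝ) < t by linarith [ht.1]).ne'
  have hint2 : IntervalIntegrable (fun t ↦ 3 / 2 * (Rone t * t ^ (-(5 / 2 : ℝ)))) volume 1 Y := by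
    refine ((continuous_Rone.continuousOn.mul (continuousOn_id.rpow_const fun t ht ↦ Or.inl ?_)).intervalIntegrable).const_mul _
    rw [uIcc_of_le hY] at ht
    exact (show (0 : ℝ) < t by linarith [ht.1]).ne'
  have h := intervalIntegral.integral_eq_sub_of_hasDeriv_right hcont hderiv (hint1.sub hint2)
  rw [intervalIntegral.integral_sub hint1 hint2, intervalIntegral.integral_const_mul, intervalIntegral.integral_of_le hY,
    intervalIntegral.integral_of_le hY, Rone_one, Real.one_rpow] at h
  linarith

/-! ## §2 The explicit formula under the integral sign -/

/-- A non-trivial zero is not `1/2` (its ordinate is at least `2δ > 0` in absolute value). -/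
theorem sub_half_ne_zero (ρ : Zeros) : (ρ : ℂ) - 1 / 2 ≠ 0 := by
  obtain ⟨δ, hδ, -, hgap⟩ := ZetaZeroSum.exists_gap_im
  intro h
  have him : ((ρ : ℂ) - 1 / 2).im = 0 := by rw [h]; simp
  rw [sub_im, show ((1 : ℂ) / 2).im = 0 by simp, sub_zero] at him
  have := hgap _ ρ.2
  rw [him, abs_zero] at this
  linarith

/-- `2δ ≤ ‖ρ − 1/2‖` with the ordinate gap `δ` of `ZetaZeroSum.exists_gap_im`. -/
theorem norm_sub_half_ge {δ : ℝ} (hgap : ∀ ρ ∈ RHWave0.riemannZetaNontrivialZeros, 2 * δ ≤ |ρ.im|) (ρ : Zeros) :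
    2 * δ ≤ ‖(ρ : ℂ) - 1 / 2‖ := by
  have h1 := hgap _ ρ.2
  have h2 := Complex.abs_im_le_norm ((ρ : ℂ) - 1 / 2)
  rw [sub_im, show ((1 : ℂ) / 2).im = 0 by simp, sub_zero] at h2
  linarith

/-- The real power as a complex power on `(0, ∞)`: `t^{ρ+1}·t^{−5/2} = t^{ρ − 3/2}`. -/
theorem cpow_mul_rpow_eq {t : ℝ} (ht : 0 < t) (ρ : ℂ) :
    (t : ℂ) ^ (ρ + 1) * ((t ^ (-(5 / 2 : ℝ)) : ℝ) : ℂ) = (t : ℂ) ^ (ρ - 3 / 2) := by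
  have ht0 : (t : ℂ) ≠ 0 := Complex.ofReal_ne_zero.2 ht.ne'
  rw [Complex.ofReal_cpow ht.le, ← Complex.cpow_add _ _ ht0]
  congr 1
  push_cast
  ring

/-- `∫_{(1,Y]} t^{ρ+1}·t^{−5/2} dt = (Y^{ρ−1/2} − 1)/(ρ − ½)` for a non-trivial zero `ρ` (`Y ≥ 1`). -/
theorem integral_cpow_mul_rpow (ρ : Zeros) {Y : ℝ} (hY : 1 ≤ Y) :
    ∫ t in Ioc 1 Y, (t : ℂ) ^ ((ρ : ℂ) + 1) * ((t ^ (-(5 / 2 : ℝ)) : ℝ) : ℂ)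
      = ((Y : ℂ) ^ ((ρ : ℂ) - 1 / 2) - 1) / ((ρ : ℂ) - 1 / 2) := by
  have heq : EqOn (fun t : ℝ ↦ (t : ℂ) ^ ((ρ : ℂ) + 1) * ((t ^ (-(5 / 2 : ℝ)) : ℝ) : ℂ))
      (fun t : ℝ ↦ (t : ℂ) ^ ((ρ : ℂ) - 3 / 2)) (Ioc 1 Y) := fun t ht ↦ cpow_mul_rpow_eq (by linarith [ht.1]) _
  have hne : (ρ : ℂ) - 3 / 2 ≠ -1 := by
    intro h
    exact sub_half_ne_zero ρ (by linear_combination h)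
  rw [setIntegral_congr_fun measurableSet_Ioc heq, ← intervalIntegral.integral_of_le hY,
    integral_cpow (Or.inr ⟨hne, by rw [uIcc_of_le hY]; exact fun h ↦ by linarith [h.1]⟩)]
  have e1 : (ρ : ℂ) - 3 / 2 + 1 = (ρ : ℂ) - 1 / 2 := by ring
  rw [e1, Complex.ofReal_one, Complex.one_cpow]

/-- The `ρ`-th term of `Z(t)t^{−5/2}` is integrable on `(1, Y]`. -/
theorem integrableOn_zeroTerm_mul_rpow (ρ : Zeros) (Y : ℝ) :
    IntegrableOn (fun t : ℝ ↦ zeroTerm ρ t * ((t ^ (-(5 / 2 : ℝ)) : ℝ) : ℂ)) (Ioc 1 Y) := by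
  have hc : ContinuousOn (fun t : ℝ ↦ zeroTerm ρ t * ((t ^ (-(5 / 2 : ℝ)) : ℝ) : ℂ)) (Icc 1 Y) := by
    refine ContinuousOn.mul ?_ (Complex.continuous_ofReal.comp_continuousOn
      (continuousOn_id.rpow_const fun t ht ↦ Or.inl (by linarith [ht.1] : (t : ℝ) ≠ 0)))
    have h : Continuous fun t : ℝ ↦ (t : ℂ) ^ ((ρ : ℂ) + 1) :=
      continuous_ofReal_cpow_const (by rw [add_re, one_re]; linarith [re_pos ρ.2])
    exact (continuous_const.mul (h.div_const _)).continuousOn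
  exact hc.integrableOn_Icc.mono_set Ioc_subset_Icc_self

/-- `∫_{(1,Y]} zeroTerm ρ t · t^{−5/2} dt = m(ρ)(Y^{ρ−1/2} − 1)/(ρ(ρ+1)(ρ − ½))`. -/
theorem integral_zeroTerm_mul_rpow (ρ : Zeros) {Y : ℝ} (hY : 1 ≤ Y) :
    ∫ t in Ioc 1 Y, zeroTerm ρ t * ((t ^ (-(5 / 2 : ℝ)) : ℝ) : ℂ)
      = (riemannZetaZeroOrder (ρ : ℂ) : ℂ) * (((Y : ℂ) ^ ((ρ : ℂ) - 1 / 2) - 1) / ((ρ : ℂ) * (ρ + 1) * ((ρ : ℂ) - 1 / 2))) := by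
  have hρ := ne_zero ρ.2
  have hρ1 := add_one_ne_zero ρ.2
  have hρh := sub_half_ne_zero ρ
  have heq : EqOn (fun t : ℝ ↦ zeroTerm ρ t * ((t ^ (-(5 / 2 : ℝ)) : ℝ) : ℂ))
      (fun t : ℝ ↦ (riemannZetaZeroOrder (ρ : ℂ) : ℂ) / ((ρ : ℂ) * (ρ + 1))
        * ((t : ℂ) ^ ((ρ : ℂ) + 1) * ((t ^ (-(5 / 2 : ℝ)) : ℝ) : ℂ))) (Ioc 1 Y) := fun t _ ↦ by
    simp only [zeroTerm]; ring
  rw [setIntegral_congr_fun measurableSet_Ioc heq, MeasureTheory.integral_const_mul, integral_cpow_mul_rpow ρ hY]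
  field_simp

/-- `‖zeroTerm ρ t · t^{−5/2}‖ ≤ ‖zeroTerm ρ 1‖ = m(ρ)/|ρ(ρ+1)|` on `[1, ∞)` (`Re ρ + 1 − 5/2 < 0`). -/
theorem norm_zeroTerm_mul_rpow_le (ρ : Zeros) {t : ℝ} (ht : 1 ≤ t) :
    ‖zeroTerm ρ t * ((t ^ (-(5 / 2 : ℝ)) : ℝ) : ℂ)‖ ≤ ‖zeroTerm ρ 1‖ := by
  have ht0 : 0 < t := by linarith
  have h1 : ‖zeroTerm ρ t‖ ≤ t ^ 2 * ‖zeroTerm ρ 1‖ := norm_zeroTerm_le_sq_mul ρ ⟨ht, le_rfl⟩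
  have hr0 : 0 < t ^ (-(5 / 2 : ℝ)) := Real.rpow_pos_of_pos ht0 _
  rw [norm_mul, Complex.norm_real, Real.norm_eq_abs, abs_of_pos hr0]
  have h2 : t ^ 2 * t ^ (-(5 / 2 : ℝ)) ≤ 1 := by
    rw [show (t ^ 2 : ℝ) = t ^ (2 : ℝ) by norm_cast, ← Real.rpow_add ht0, show (2 + -(5 / 2 : ℝ)) = -(1 / 2) by norm_num]
    exact Real.rpow_le_one_of_one_le_of_nonpos ht (by norm_num)
  calc ‖zeroTerm ρ t‖ * t ^ (-(5 / 2 : ℝ)) ≤ t ^ 2 * ‖zeroTerm ρ 1‖ * t ^ (-(5 / 2 : ℝ)) :=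
        mul_le_mul_of_nonneg_right h1 hr0.le
    _ = (t ^ 2 * t ^ (-(5 / 2 : ℝ))) * ‖zeroTerm ρ 1‖ := by ring
    _ ≤ 1 * ‖zeroTerm ρ 1‖ := mul_le_mul_of_nonneg_right h2 (norm_nonneg _)
    _ = ‖zeroTerm ρ 1‖ := one_mul _

/-- **`∫_{(1,Y]} Z(t)t^{−5/2} dt = Σ_ρ m(ρ)(Y^{ρ−1/2} − 1)/(ρ(ρ+1)(ρ − ½))`** (dominated convergence; unconditional). -/
theorem integral_Zsum_mul_rpow {Y : ℝ} (hY : 1 ≤ Y) :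
    ∫ t in Ioc 1 Y, Zsum t * ((t ^ (-(5 / 2 : ℝ)) : ℝ) : ℂ)
      = ∑' ρ : Zeros, (riemannZetaZeroOrder (ρ : ℂ) : ℂ)
          * (((Y : ℂ) ^ ((ρ : ℂ) - 1 / 2) - 1) / ((ρ : ℂ) * (ρ + 1) * ((ρ : ℂ) - 1 / 2))) := by
  have hsum : Summable fun ρ : Zeros ↦ ∫ t in Ioc 1 Y, ‖zeroTerm ρ t * ((t ^ (-(5 / 2 : ℝ)) : ℝ) : ℂ)‖ := by
    refine Summable.of_nonneg_of_le (fun ρ ↦ integral_nonneg fun t ↦ norm_nonneg _) (fun ρ ↦ ?_)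
      ((summable_norm_psiOne_zeroTerm le_rfl).mul_left (Y - 1))
    calc ∫ t in Ioc 1 Y, ‖zeroTerm ρ t * ((t ^ (-(5 / 2 : ℝ)) : ℝ) : ℂ)‖ ≤ ∫ t in Ioc 1 Y, ‖zeroTerm ρ 1‖ :=
          setIntegral_mono_on (integrableOn_zeroTerm_mul_rpow ρ Y).norm (by exact integrableOn_const (by simp))
            measurableSet_Ioc fun t ht ↦ norm_zeroTerm_mul_rpow_le ρ ht.1.le
      _ = (Y - 1) * ‖zeroTerm ρ 1‖ := by
          rw [setIntegral_const, smul_eq_mul, measureReal_def, Real.volume_Ioc, ENNReal.toReal_ofReal (by linarith)]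
  have h := integral_tsum_of_summable_integral_norm (μ := volume.restrict (Ioc 1 Y))
    (F := fun (ρ : Zeros) (t : ℝ) ↦ zeroTerm ρ t * ((t ^ (-(5 / 2 : ℝ)) : ℝ) : ℂ)) (fun ρ ↦ integrableOn_zeroTerm_mul_rpow ρ Y) hsum
  have hlhs : ∫ t in Ioc 1 Y, Zsum t * ((t ^ (-(5 / 2 : ℝ)) : ℝ) : ℂ)
      = ∫ t in Ioc 1 Y, ∑' ρ : Zeros, zeroTerm ρ t * ((t ^ (-(5 / 2 : ℝ)) : ℝ) : ℂ) := by
    refine integral_congr_ae (ae_of_all _ fun t ↦ ?_)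
    simp only [Zsum]
    exact tsum_mul_right.symm
  rw [hlhs, ← h]
  exact tsum_congr fun ρ ↦ integral_zeroTerm_mul_rpow ρ hY

/-! ## §3 Under RH the series is bounded uniformly in `Y` -/

/-- Under RH every term of the series is at most `m(ρ)/(δ|ρ|²)` in norm (`|Y^{ρ−1/2}| = 1`, `|ρ+1| ≥ |ρ|`, `|ρ − ½| ≥ 2δ`). -/
theorem norm_term_le_of_RH (hRH : RiemannHypothesis) {δ : ℝ} (hδ : 0 < δ)
    (hgap : ∀ ρ ∈ RHWave0.riemannZetaNontrivialZeros, 2 * δ ≤ |ρ.im|) (ρ : Zeros) {Y : ℝ} (hY : 1 ≤ Y) :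
    ‖(riemannZetaZeroOrder (ρ : ℂ) : ℂ) * (((Y : ℂ) ^ ((ρ : ℂ) - 1 / 2) - 1) / ((ρ : ℂ) * (ρ + 1) * ((ρ : ℂ) - 1 / 2)))‖
      ≤ (1 / δ) * ((riemannZetaZeroOrder (ρ : ℂ) : ℝ) / ‖(ρ : ℂ)‖ ^ 2) := by
  have hY0 : 0 < Y := by linarith
  have hm := zeroOrder_nonneg' ρ
  have hre := re_eq_half_of_RH hRH ρ.2
  have hρ0 : 0 < ‖(ρ : ℂ)‖ := norm_pos_iff.2 (ne_zero ρ.2)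
  have hρ1 : ‖(ρ : ℂ)‖ ≤ ‖(ρ : ℂ) + 1‖ := norm_le_norm_add_one ρ.2
  have hρh : 2 * δ ≤ ‖(ρ : ℂ) - 1 / 2‖ := norm_sub_half_ge hgap ρ
  have hpow : ‖(Y : ℂ) ^ ((ρ : ℂ) - 1 / 2)‖ = 1 := by
    rw [Complex.norm_cpow_eq_rpow_re_of_pos hY0, sub_re, hre, show ((1 : ℂ) / 2).re = 1 / 2 by simp, sub_self, Real.rpow_zero]
  have hnum : ‖(Y : ℂ) ^ ((ρ : ℂ) - 1 / 2) - 1‖ ≤ 2 := by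
    calc ‖(Y : ℂ) ^ ((ρ : ℂ) - 1 / 2) - 1‖ ≤ ‖(Y : ℂ) ^ ((ρ : ℂ) - 1 / 2)‖ + ‖(1 : ℂ)‖ := norm_sub_le _ _
      _ = 2 := by rw [hpow, norm_one]; norm_num
  have hden : 2 * δ * ‖(ρ : ℂ)‖ ^ 2 ≤ ‖(ρ : ℂ) * (ρ + 1) * ((ρ : ℂ) - 1 / 2)‖ := by
    rw [norm_mul, norm_mul]
    calc 2 * δ * ‖(ρ : ℂ)‖ ^ 2 = ‖(ρ : ℂ)‖ * ‖(ρ : ℂ)‖ * (2 * δ) := by ring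
      _ ≤ ‖(ρ : ℂ)‖ * ‖(ρ : ℂ) + 1‖ * ‖(ρ : ℂ) - 1 / 2‖ := by
          gcongr
  have hdenpos : 0 < 2 * δ * ‖(ρ : ℂ)‖ ^ 2 := by positivity
  rw [norm_mul, Complex.norm_intCast, abs_of_nonneg hm, norm_div]
  calc (riemannZetaZeroOrder (ρ : ℂ) : ℝ) * (‖(Y : ℂ) ^ ((ρ : ℂ) - 1 / 2) - 1‖ / ‖(ρ : ℂ) * (ρ + 1) * ((ρ : ℂ) - 1 / 2)‖)
      ≤ (riemannZetaZeroOrder (ρ : ℂ) : ℝ) * (2 / (2 * δ * ‖(ρ : ℂ)‖ ^ 2)) := by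
        refine mul_le_mul_of_nonneg_left ?_ hm
        exact div_le_div₀ (by norm_num) hnum hdenpos hden
    _ = (1 / δ) * ((riemannZetaZeroOrder (ρ : ℂ) : ℝ) / ‖(ρ : ℂ)‖ ^ 2) := by
        field_simp

/-- **Under RH, `‖∫_{(1,Y]} Z(t)t^{−5/2} dt‖ ≤ (1/δ)·Σ_ρ m(ρ)/|ρ|²`** for every `Y ≥ 1`. -/
theorem norm_integral_Zsum_mul_rpow_le_of_RH (hRH : RiemannHypothesis) {δ : ℝ} (hδ : 0 < δ)
    (hgap : ∀ ρ ∈ RHWave0.riemannZetaNontrivialZeros, 2 * δ ≤ |ρ.im|) {Y : ℝ} (hY : 1 ≤ Y) :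
    ‖∫ t in Ioc 1 Y, Zsum t * ((t ^ (-(5 / 2 : ℝ)) : ℝ) : ℂ)‖
      ≤ (1 / δ) * ∑' ρ : Zeros, (riemannZetaZeroOrder (ρ : ℂ) : ℝ) / ‖(ρ : ℂ)‖ ^ 2 := by
  rw [integral_Zsum_mul_rpow hY, ← tsum_mul_left]
  have hs : Summable fun ρ : Zeros ↦ (1 / δ) * ((riemannZetaZeroOrder (ρ : ℂ) : ℝ) / ‖(ρ : ℂ)‖ ^ 2) :=
    summable_zeroOrder_div_norm_sq.mul_left _
  have hn : Summable fun ρ : Zeros ↦ ‖(riemannZetaZeroOrder (ρ : ℂ) : ℂ)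
      * (((Y : ℂ) ^ ((ρ : ℂ) - 1 / 2) - 1) / ((ρ : ℂ) * (ρ + 1) * ((ρ : ℂ) - 1 / 2)))‖ :=
    Summable.of_nonneg_of_le (fun _ ↦ norm_nonneg _) (fun ρ ↦ norm_term_le_of_RH hRH hδ hgap ρ hY) hs
  exact (norm_tsum_le_tsum_norm hn).trans (hn.tsum_le_tsum (fun ρ ↦ norm_term_le_of_RH hRH hδ hgap ρ hY) hs)

/-! ## §4 The remainder and the linear term -/

/-- `E(t)t^{−5/2}` is integrable on `(1, Y]`. -/
theorem integrableOn_psiOneRemainder_mul_rpow (Y : ℝ) :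
    IntegrableOn (fun t : ℝ ↦ psiOneRemainder t * ((t ^ (-(5 / 2 : ℝ)) : ℝ) : ℂ)) (Ioc 1 Y) :=
  ((continuousOn_psiOneRemainder.mono Icc_subset_Ici_self).mul (Complex.continuous_ofReal.comp_continuousOn
    (continuousOn_id.rpow_const fun t ht ↦ Or.inl (by linarith [ht.1] : (t : ℝ) ≠ 0)))).integrableOn_Icc.mono_set
    Ioc_subset_Icc_self

/-- `‖∫_{(1,Y]} E(t)t^{−5/2} dt‖ ≤ C` when `‖E(t)‖ ≤ C√t` (`∫₁^Y t^{−2} ≤ 1`). -/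
theorem norm_integral_psiOneRemainder_mul_rpow_le {C Y : ℝ}
    (hC : ∀ x : ℝ, 0 < x → ‖psiOneRemainder x‖ ≤ C * Real.sqrt x) (hY : 1 ≤ Y) :
    ‖∫ t in Ioc 1 Y, psiOneRemainder t * ((t ^ (-(5 / 2 : ℝ)) : ℝ) : ℂ)‖ ≤ C := by
  have hC0 : 0 ≤ C := by
    have h := hC 1 one_pos
    rw [Real.sqrt_one, mul_one] at h
    exact (norm_nonneg _).trans h
  have hg : IntegrableOn (fun t : ℝ ↦ C * t ^ (-(2 : ℝ))) (Ioc 1 Y) :=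
    ((continuousOn_id.rpow_const fun t ht ↦ Or.inl (by linarith [ht.1] : (t : ℝ) ≠ 0)).integrableOn_Icc.mono_set
      Ioc_subset_Icc_self).const_mul C
  have hle : ∀ᵐ t ∂volume.restrict (Ioc 1 Y), ‖psiOneRemainder t * ((t ^ (-(5 / 2 : ℝ)) : ℝ) : ℂ)‖ ≤ C * t ^ (-(2 : ℝ)) := by
    refine (ae_restrict_iff' measurableSet_Ioc).2 (ae_of_all _ fun t ht ↦ ?_)
    have ht0 : 0 < t := by linarith [ht.1]
    have hr0 : 0 < t ^ (-(5 / 2 : ℝ)) := Real.rpow_pos_of_pos ht0 _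
    rw [norm_mul, Complex.norm_real, Real.norm_eq_abs, abs_of_pos hr0]
    calc ‖psiOneRemainder t‖ * t ^ (-(5 / 2 : ℝ)) ≤ C * Real.sqrt t * t ^ (-(5 / 2 : ℝ)) :=
          mul_le_mul_of_nonneg_right (hC t ht0) hr0.le
      _ = C * t ^ (-(2 : ℝ)) := by
          rw [Real.sqrt_eq_rpow, mul_assoc, ← Real.rpow_add ht0]; norm_num
  refine (norm_integral_le_of_norm_le hg hle).trans ?_
  rw [MeasureTheory.integral_const_mul, ← intervalIntegral.integral_of_le hY,
    integral_rpow (Or.inr ⟨by norm_num, by rw [uIcc_of_le hY]; exact fun h ↦ by linarith [h.1]⟩)]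
  have hY0 : 0 < Y := by linarith
  have h1 : 0 ≤ Y ^ (-(2 : ℝ) + 1) := Real.rpow_nonneg hY0.le _
  rw [Real.one_rpow, show (-(2 : ℝ) + 1) = -1 by norm_num] at *
  have : (Y ^ (-1 : ℝ) - 1) / (-1 : ℝ) = 1 - Y ^ (-1 : ℝ) := by ring
  rw [this]
  nlinarith

/-- `∫_{(1,Y]} R₁(t)t^{−5/2} dt = −Re ∫ Z·t^{−5/2} − (log 2π)∫_{(1,Y]} t^{−3/2} + Re ∫ E·t^{−5/2}`. -/
theorem integral_Rone_mul_rpow (Y : ℝ) :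
    ∫ t in Ioc 1 Y, Rone t * t ^ (-(5 / 2 : ℝ))
      = -(∫ t in Ioc 1 Y, Zsum t * ((t ^ (-(5 / 2 : ℝ)) : ℝ) : ℂ)).re
        - Real.log (2 * π) * (∫ t in Ioc 1 Y, t ^ (-(3 / 2 : ℝ)))
        + (∫ t in Ioc 1 Y, psiOneRemainder t * ((t ^ (-(5 / 2 : ℝ)) : ℝ) : ℂ)).re := by
  have hpc : ContinuousOn (fun t : ℝ ↦ ((t ^ (-(5 / 2 : ℝ)) : ℝ) : ℂ)) (Icc 1 Y) :=
    Complex.continuous_ofReal.comp_continuousOn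
      (continuousOn_id.rpow_const fun t ht ↦ Or.inl (by linarith [ht.1] : (t : ℝ) ≠ 0))
  have hZ : IntegrableOn (fun t : ℝ ↦ Zsum t * ((t ^ (-(5 / 2 : ℝ)) : ℝ) : ℂ)) (Ioc 1 Y) :=
    ((continuousOn_Zsum_Icc Y).mul hpc).integrableOn_Icc.mono_set Ioc_subset_Icc_self
  have hE := integrableOn_psiOneRemainder_mul_rpow Y
  have h32 : IntegrableOn (fun t : ℝ ↦ t ^ (-(3 / 2 : ℝ))) (Ioc 1 Y) :=
    ((continuousOn_id.rpow_const fun t ht ↦ Or.inl (by linarith [ht.1] : (t : ℝ) ≠ 0)).integrableOn_Icc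
      (a := 1) (b := Y)).mono_set Ioc_subset_Icc_self
  have hre : ∀ (z : ℂ) (r : ℝ), (z * (r : ℂ)).re = z.re * r := fun z r ↦ by simp [Complex.mul_re]
  have heq : EqOn (fun t : ℝ ↦ Rone t * t ^ (-(5 / 2 : ℝ)))
      (fun t ↦ -(Zsum t * ((t ^ (-(5 / 2 : ℝ)) : ℝ) : ℂ)).re - Real.log (2 * π) * t ^ (-(3 / 2 : ℝ))
        + (psiOneRemainder t * ((t ^ (-(5 / 2 : ℝ)) : ℝ) : ℂ)).re) (Ioc 1 Y) := by
    intro t ht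
    have ht0 : 0 < t := by linarith [ht.1]
    simp only [hre]
    rw [Rone_eq_re ht.1.le]
    have e : t * t ^ (-(5 / 2 : ℝ)) = t ^ (-(3 / 2 : ℝ)) := by
      rw [show (-(3 / 2 : ℝ)) = 1 + -(5 / 2 : ℝ) by norm_num, Real.rpow_add ht0, Real.rpow_one]
    calc (-(Zsum t).re - t * Real.log (2 * π) + (psiOneRemainder t).re) * t ^ (-(5 / 2 : ℝ))
        = -((Zsum t).re * t ^ (-(5 / 2 : ℝ))) - Real.log (2 * π) * (t * t ^ (-(5 / 2 : ℝ)))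
          + (psiOneRemainder t).re * t ^ (-(5 / 2 : ℝ)) := by ring
      _ = _ := by rw [e]
  have i1 : Integrable (fun t : ℝ ↦ -(Zsum t * ((t ^ (-(5 / 2 : ℝ)) : ℝ) : ℂ)).re) (volume.restrict (Ioc 1 Y)) := hZ.re.neg
  have i2 : Integrable (fun t : ℝ ↦ Real.log (2 * π) * t ^ (-(3 / 2 : ℝ))) (volume.restrict (Ioc 1 Y)) := h32.const_mul _
  have i12 : Integrable (fun t : ℝ ↦ -(Zsum t * ((t ^ (-(5 / 2 : ℝ)) : ℝ) : ℂ)).re - Real.log (2 * π) * t ^ (-(3 / 2 : ℝ)))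
      (volume.restrict (Ioc 1 Y)) := i1.sub i2
  have i3 : Integrable (fun t : ℝ ↦ (psiOneRemainder t * ((t ^ (-(5 / 2 : ℝ)) : ℝ) : ℂ)).re) (volume.restrict (Ioc 1 Y)) := hE.re
  rw [setIntegral_congr_fun measurableSet_Ioc heq, MeasureTheory.integral_add i12 i3, MeasureTheory.integral_sub i1 i2,
    MeasureTheory.integral_neg, MeasureTheory.integral_const_mul, ← re_setIntegral_eq hZ, ← re_setIntegral_eq hE]

/-- `0 ≤ ∫_{(1,Y]} t^{−3/2} dt ≤ 2` (`= 2(1 − Y^{−1/2})`). -/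
theorem integral_rpow_neg_three_halves_mem {Y : ℝ} (hY : 1 ≤ Y) :
    (∫ t in Ioc 1 Y, t ^ (-(3 / 2 : ℝ))) ∈ Icc (0 : ℝ) 2 := by
  have hY0 : 0 < Y := by linarith
  rw [← intervalIntegral.integral_of_le hY,
    integral_rpow (Or.inr ⟨by norm_num, by rw [uIcc_of_le hY]; exact fun h ↦ by linarith [h.1]⟩), Real.one_rpow,
    show (-(3 / 2 : ℝ) + 1) = -(1 / 2) by norm_num]
  have h1 : 0 ≤ Y ^ (-(1 / 2) : ℝ) := Real.rpow_nonneg hY0.le _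
  have h2 : Y ^ (-(1 / 2) : ℝ) ≤ 1 := Real.rpow_le_one_of_one_le_of_nonpos hY (by norm_num)
  constructor
  · rw [le_div_iff_of_neg (by norm_num)]; linarith
  · rw [div_le_iff_of_neg (by norm_num)]; linarith

/-! ## §5 Assembly -/

/-- **Under RH the `t^{−3/2}`-weighted first moment of `ψ(t) − t` is bounded**: there is `C` with
`|∫_{(1,Y]} (ψ(t) − t)t^{−3/2} dt| ≤ C` for every `Y ≥ 1`. [folklore; MV §13.1 method] -/
theorem exists_abs_integral_psi_sub_mul_rpow_le_of_RH (hRH : RiemannHypothesis) :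
    ∃ C : ℝ, ∀ Y : ℝ, 1 ≤ Y → |∫ t in Ioc 1 Y, (ψ t - t) * t ^ (-(3 / 2 : ℝ))| ≤ C := by
  obtain ⟨CR, hCR⟩ := exists_abs_Rone_le_of_RH hRH
  obtain ⟨CE, hCE0, hCE⟩ := exists_norm_psiOneRemainder_le
  obtain ⟨δ, hδ, -, hgap⟩ := ZetaZeroSum.exists_gap_im
  set B := ∑' ρ : Zeros, (riemannZetaZeroOrder (ρ : ℂ) : ℝ) / ‖(ρ : ℂ)‖ ^ 2 with hB
  refine ⟨|CR| + 1 / 2 + 3 / 2 * ((1 / δ) * B + Real.log (2 * π) * 2 + CE), fun Y hY ↦ ?_⟩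
  have hY0 : 0 < Y := by linarith
  rw [integral_psi_sub_mul_rpow_eq hY, integral_Rone_mul_rpow Y]
  have h1 : |Rone Y * Y ^ (-(3 / 2 : ℝ))| ≤ |CR| := by
    have hr0 : 0 < Y ^ (-(3 / 2 : ℝ)) := Real.rpow_pos_of_pos hY0 _
    rw [abs_mul, abs_of_pos hr0]
    calc |Rone Y| * Y ^ (-(3 / 2 : ℝ)) ≤ CR * Y ^ (3 / 2 : ℝ) * Y ^ (-(3 / 2 : ℝ)) :=
          mul_le_mul_of_nonneg_right (hCR Y hY) hr0.le
      _ = CR := by rw [mul_assoc, ← Real.rpow_add hY0]; norm_num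
      _ ≤ |CR| := le_abs_self _
  have h2 : |(∫ t in Ioc 1 Y, Zsum t * ((t ^ (-(5 / 2 : ℝ)) : ℝ) : ℂ)).re| ≤ (1 / δ) * B :=
    (Complex.abs_re_le_norm _).trans (norm_integral_Zsum_mul_rpow_le_of_RH hRH hδ hgap hY)
  have h3 := integral_rpow_neg_three_halves_mem hY
  have h4 : |(∫ t in Ioc 1 Y, psiOneRemainder t * ((t ^ (-(5 / 2 : ℝ)) : ℝ) : ℂ)).re| ≤ CE :=
    (Complex.abs_re_le_norm _).trans (norm_integral_psiOneRemainder_mul_rpow_le hCE hY)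
  have hlog : 0 ≤ Real.log (2 * π) := Real.log_nonneg (by linarith [Real.pi_gt_three])
  have h5 : |Real.log (2 * π) * ∫ t in Ioc 1 Y, t ^ (-(3 / 2 : ℝ))| ≤ Real.log (2 * π) * 2 := by
    rw [abs_mul, abs_of_nonneg hlog, abs_of_nonneg h3.1]
    exact mul_le_mul_of_nonneg_left h3.2 hlog
  have key : ∀ r z l e : ℝ, |r| ≤ |CR| → |z| ≤ (1 / δ) * B → |l| ≤ Real.log (2 * π) * 2 → |e| ≤ CE →
      |r + 1 / 2 + 3 / 2 * (-z - l + e)| ≤ |CR| + 1 / 2 + 3 / 2 * ((1 / δ) * B + Real.log (2 * π) * 2 + CE) := by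
    intro r z l e hr hz hl he
    obtain ⟨hr1, hr2⟩ := abs_le.1 hr
    obtain ⟨hz1, hz2⟩ := abs_le.1 hz
    obtain ⟨hl1, hl2⟩ := abs_le.1 hl
    obtain ⟨he1, he2⟩ := abs_le.1 he
    rw [abs_le]
    constructor <;> linarith
  exact key _ _ _ _ h1 h2 h5 h4

/-! ## §6 In the logarithmic variable: the primitive of the Cramér function is bounded -/

/-- **`∫_{(0,V]} e^{−u/2}(ψ(e^u) − e^u) du = ∫_{(1,e^V]} (ψ(t) − t)t^{−3/2} dt`** (`t = e^u`). -/
theorem integral_cramerFn_eq (V : ℝ) :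
    ∫ u in Ioc 0 V, Real.exp (-(u / 2)) * (ψ (Real.exp u) - Real.exp u)
      = ∫ t in Ioc 1 (Real.exp V), (ψ t - t) * t ^ (-(3 / 2 : ℝ)) := by
  have himg : Real.exp '' Ioc 0 V = Ioc 1 (Real.exp V) := by rw [Real.image_exp_Ioc, Real.exp_zero]
  rw [← himg, integral_image_eq_integral_abs_deriv_smul measurableSet_Ioc
    (fun u _ ↦ (Real.hasDerivAt_exp u).hasDerivWithinAt) (Real.exp_injective.injOn)]
  refine setIntegral_congr_fun measurableSet_Ioc fun u _ ↦ ?_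
  have he : 0 < Real.exp u := Real.exp_pos u
  have hpow : Real.exp u ^ (-(3 / 2 : ℝ)) = Real.exp (-(3 / 2) * u) := by
    rw [← Real.exp_mul]; ring_nf
  have hmul : Real.exp u * Real.exp (-(3 / 2) * u) = Real.exp (-(u / 2)) := by
    rw [← Real.exp_add]; ring_nf
  rw [abs_of_pos he, smul_eq_mul, hpow, ← hmul]
  ring

/-- **Under RH the primitive of the Cramér function `g(u) = e^{−u/2}(ψ(e^u) − e^u)` is bounded**:
`∃ C, ∀ V ≥ 0, |∫₀^V e^{−u/2}(ψ(e^u) − e^u) du| ≤ C`. [folklore] -/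
theorem exists_abs_integral_cramerFn_le_of_RH (hRH : RiemannHypothesis) :
    ∃ C : ℝ, ∀ V : ℝ, 0 ≤ V → |∫ u in (0 : ℝ)..V, Real.exp (-(u / 2)) * (ψ (Real.exp u) - Real.exp u)| ≤ C := by
  obtain ⟨C, hC⟩ := exists_abs_integral_psi_sub_mul_rpow_le_of_RH hRH
  refine ⟨C, fun V hV ↦ ?_⟩
  rw [intervalIntegral.integral_of_le hV, integral_cramerFn_eq V]
  exact hC _ (Real.one_le_exp hV)

end FloorResidualMean

end Summit.RiemannHypothesis.RiemannHypothesis.Theorems.WeilFormatC
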